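import Summits.CriticalPhenomena.Ising3DConformalLimit.Theses.InverseSquareTelemetry
import Summits.CriticalPhenomena.Ising3DConformalLimit.Theorems.GaussianLimitNotScreened.Negative.Reformulation
import Summits.CriticalPhenomena.Ising3DConformalLimit.Theorems.HyperoctahedralRPLimitRotationInvariant
import Summits.CriticalPhenomena.Ising3DConformalLimit.Theorems.GaussianScaleMixtureRotationUpgradeFromTwoPointEdgeGaussianity
import Summits.CriticalPhenomena.Ising3DConformalLimit.Theorems.PrecisionLaplacianMoebiusLimitOfTwoPointLawBareExistence
import Summits.CriticalPhenomena.Ising3DConformalLimit.Theorems.MoebiusLimitExists.Negative.ScaleRedundant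
import HarnessLib

/-!
# Crux `InverseSquareTelemetry.TwoPointSpineComplement` (stmt-CriticalPhenomena-4497), line `registered`, lead c3:
# the Coulomb corner `Δ = 1/2` is EMPTY — `(C)` forbids the exact Coulomb law

THEOREM-ONLY helper file (`--supports stmt-CriticalPhenomena-4497`; no definition, no named fact, no `sorry`).

The registered skeleton of this crux splits clause (iii) `U₄ ≢ 0` by the dimension `Δ` of the two-point law into
the Coulomb corner `Δ = 1/2` (stub α′ `stub_coulombCorner`: under `⟨σ₀σ_x⟩·|x|₂ → c > 0`, every non-degenerate
Möbius-covariant pointwise limit of `criticalCorr 3` with `Δ = 1/2` has `U₄ ≢ 0`), the window `1/2 < Δ < 3/4` (β) and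
the corner `Δ = 3/4` (γ). This file shows that the CONCLUSION of α′ is never true, using only landed theorems of the
tree: the closing theorems of cruxes stmt-8367 (`rotationUpgradeFromTwoPoint_proof`, whose EDGE case is
`edge_limitConnectedFour_eq_zero` / `half_lt_delta_of_hasNontrivialU4`: at `Δ = 1/2` nine-mirror OS positivity + the
harmonic OS null vector + Bôcher–Liouville force `U₄ ≡ 0`), stmt-1980 (`limitRotationInvariant_proof`) and stmt-1979
(`HRP2Rigidity_of`). Consequences, kernel-checked here:

* `half_lt_of_hasNontrivialU4` — **interaction forces an anomalous dimension, for ARBITRARY pointwise limits**: a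
  non-degenerate pointwise limit `(ρ, S)` of `criticalCorr 3` that is scale covariant with `Δ` and has `U₄ ≢ 0` has
  `1/2 < Δ` (no normalisation, no Euclidean or inversion hypothesis: translations are free, `O(3)` is the proved 1980).
* `not_hasNontrivialU4_of_scaleCovariant_half`, `not_hasNontrivialU4_of_moebius_half` — at `Δ = 1/2` every such limit is
  Gaussian at order four; so the conclusion `HasNontrivialU4 S` of stub α′ is FALSE for every `S` meeting its hypotheses.
* `not_hasNontrivialU4_of_coulombLaw` — **under the exact Coulomb law EVERY non-degenerate pointwise limit of
  `criticalCorr 3` (any renormalisation, no covariance asked) has `U₄ ≡ 0`** (dilations with `Δ = 1/2` are free under the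
  law, `isScaleCovariant_of_limit`).
* `noCoulombLaw_of_twoPointSpineComplement` — **`(C)` implies that the critical two-point function of `ℤ³` has NO exact
  isotropic Coulomb asymptotics** (`∀ c > 0, ¬ ⟨σ₀σ_x⟩·|x|₂^{2·(1/2)} → c`); equivalently
  `not_twoPointSpineComplement_of_coulombLaw`: in the (unexpected, `η ≈ 0.036`) world `η_law = 0` the crux is FALSE.
  `window_of_twoPointSpineComplement`: under `(C)` every witness `(Δ, c)` of the law has `1/2 < Δ ≤ 3/4`.
* the corner stub RESHAPED: `stub_coulombCorner_iff_noMoebiusHalfLimit` (α′ ⟺ "under the Coulomb law no non-degenerate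
  Möbius(1/2) limit exists") and `stub_coulombCorner_of_noCoulombLaw` (α″ ⟹ α′): the corner can only be closed by its
  EMPTINESS, the bare two-point statement α″ = `NoCoulombLaw` (skeleton v3's `stub_noCoulombLaw`), necessary for the crux.
  Its payer edges, the implication "v2 stubs ⟹ α″", the v3 composition and the exact residual `(C) ↔ D₂ ∧ I₂ ∧ α″ ∧ β′ ∧ γ′`
  are the sibling file `…HalfEdgeEdges.lean`.

References: Pohlmeyer, Comm. Math. Phys. 12 (1969) 204 (a scale-invariant field of canonical dimension is free);
Di Francesco–Mathieu–Sénéchal (1997) §4.3.1; Duminil-Copin, ICM 2022, §8.4; El-Showk et al., J. Stat. Phys. 157 (2014)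
(`Δ_σ ≈ 0.518 > 1/2`).
-/

noncomputable section

namespace Summit.CriticalPhenomena.Ising3DConformalLimit.InverseSquareTelemetryTwoPointSpineComplement.HalfEdge

open Literature.Probability.LatticeModels Filter Topology EuclideanGeometry
open Summit.CriticalPhenomena.Ising3DConformalLimit.Theses
open Summit.CriticalPhenomena.Ising3DConformalLimit.Theses.InverseSquareTelemetry
  (TwoPointSpineComplement IsingEuclidUpgradeR2RotInvPowerLaw)
open Summit.CriticalPhenomena.Ising3DConformalLimit.Theses.PrecisionLaplacian
  (MoebiusLimitOfTwoPointLaw IsingEuclidUpgradeR4NonGaussian)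
open Summit.CriticalPhenomena.Ising3DConformalLimit.MoebiusLimitExistsNegative
  (normalised_hasLimit normalised_nondeg normalised_rotation normalised_scale hasNontrivialU4_normalised_iff
    isTranslationInvariant_normalised_of_limit)
open Summit.CriticalPhenomena.Ising3DConformalLimit.Cruxes.LimitRotationInvariant.QuarterTurnLiouville
  (limitRotationInvariant_proof)
open Summit.CriticalPhenomena.Ising3DConformalLimit.Cruxes.RotationUpgradeFromTwoPoint.NullLaplacianEdgeGaussianity
  (half_lt_delta_of_hasNontrivialU4 edge_limitConnectedFour_eq_zero)
open Summit.CriticalPhenomena.Ising3DConformalLimit.PrecisionLaplacianMoebiusLimitOfTwoPointLaw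
  (isScaleCovariant_of_limit)
open Summit.CriticalPhenomena.Ising3DConformalLimit.GaussianLimitNotScreenedNegative (dimension_window_and_eta)

/-! ### Interaction forces `Δ > 1/2`, for arbitrary pointwise limits -/

section Window

variable {ρ : ℝ → ℝ} {Δ : ℝ} {S : CorrFamily 3}

/-- **Interaction forces an anomalous dimension.** A non-degenerate pointwise scaling limit `(ρ, S)` of
`criticalCorr 3` (`ρ > 0` on `(0,1]`) which is scale covariant with dimension `Δ` and has `U₄ ≢ 0` has `1/2 < Δ`.
Proof: normalise `S` off `NonCoincident` (same limit, same `U₄` on non-coincident quadruples); translations are free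
(`isTranslationInvariant_normalised_of_limit`), `O(3)` invariance is the proved crux stmt-1980
(`limitRotationInvariant_proof` fed the proved stmt-1979 `HRP2Rigidity_of`), and the edge theorem of crux stmt-8367
(`half_lt_delta_of_hasNontrivialU4`: at `Δ = 1/2` the OS null vector of the harmonic kernel + Bôcher–Liouville give
`U₄ ≡ 0`) concludes. [cite: Pohlmeyer1969, Thm. p. 204] -/
theorem half_lt_of_hasNontrivialU4 (hρ : ∀ δ ∈ Set.Ioc (0:ℝ) 1, 0 < ρ δ)
    (hlim : HasPointwiseScalingLimit (criticalCorr 3) ρ S) (hnd : IsNondegenerateTwoPoint S)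
    (hsc : IsScaleCovariant Δ S) (hU : HasNontrivialU4 S) : 1 / 2 < Δ := by
  classical
  set S' : CorrFamily 3 := fun n x => if x ∈ NonCoincident 3 n then S n x else 0 with hS'
  have hlim' : HasPointwiseScalingLimit (criticalCorr 3) ρ S' := normalised_hasLimit hlim
  have hnorm' : ∀ n z, z ∉ NonCoincident 3 n → S' n z = 0 := fun n z hz => by
    simp only [hS', if_neg hz]
  have hnd' : IsNondegenerateTwoPoint S' := normalised_nondeg hnd
  have htr' : IsTranslationInvariant S' := isTranslationInvariant_normalised_of_limit hlim
  have hsc' : IsScaleCovariant Δ S' := normalised_scale hsc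
  have hrot' : IsRotationInvariant S' :=
    limitRotationInvariant_proof
      _root_.Summit.CriticalPhenomena.Ising3DConformalLimit.Cruxes.HRP2Rigidity.XRayMellin.HRP2Rigidity_of
      ρ Δ S' hρ hlim' hnorm' hnd' htr' hsc'
  have hiso' : ∀ (R : EuclideanSpace ℝ (Fin 3) ≃ₗᵢ[ℝ] EuclideanSpace ℝ (Fin 3))
      (x : EuclideanSpace ℝ (Fin 3)), x ≠ 0 → S' 2 ![0, R x] = S' 2 ![0, x] := by
    intro R x _
    have h := hrot' 2 R ![0, x]
    rw [← h]
    congr 1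
    funext i
    fin_cases i <;> simp
  have hU' : HasNontrivialU4 S' := hasNontrivialU4_normalised_iff.2 hU
  exact half_lt_delta_of_hasNontrivialU4 hρ hlim' hnorm' hnd' htr' hsc' hiso' hU'

/-- **At `Δ = 1/2` every scale-covariant non-degenerate pointwise limit of `criticalCorr 3` is Gaussian at order
four** (contrapositive of `half_lt_of_hasNontrivialU4`). [cite: Pohlmeyer1969, Thm. p. 204] -/
theorem not_hasNontrivialU4_of_scaleCovariant_half (hρ : ∀ δ ∈ Set.Ioc (0:ℝ) 1, 0 < ρ δ)
    (hlim : HasPointwiseScalingLimit (criticalCorr 3) ρ S) (hnd : IsNondegenerateTwoPoint S)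
    (hsc : IsScaleCovariant (1 / 2) S) : ¬ HasNontrivialU4 S :=
  fun hU => lt_irrefl _ (half_lt_of_hasNontrivialU4 hρ hlim hnd hsc hU)

/-- **The conclusion of stub α′ is never true**: a non-degenerate pointwise limit of `criticalCorr 3` that is Möbius
covariant with `Δ = 1/2` has `U₄ ≡ 0` on non-coincident quadruples. [cite: Pohlmeyer1969, Thm. p. 204] -/
theorem not_hasNontrivialU4_of_moebius_half (hρ : ∀ δ ∈ Set.Ioc (0:ℝ) 1, 0 < ρ δ)
    (hlim : HasPointwiseScalingLimit (criticalCorr 3) ρ S) (hnd : IsNondegenerateTwoPoint S)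
    (hm : IsMoebiusCovariant (1 / 2) S) : ¬ HasNontrivialU4 S :=
  not_hasNontrivialU4_of_scaleCovariant_half hρ hlim hnd hm.isScaleCovariant

/-- **A witness of the conjunct has `1/2 < Δ ≤ 3/4`.** For every non-degenerate pointwise limit of `criticalCorr 3`
that is Möbius (indeed scale) covariant with `Δ` and has `U₄ ≢ 0`: `1/2 < Δ` (`half_lt_of_hasNontrivialU4`) and
`Δ ≤ 3/4` (`dimension_window_and_eta`: Duminil-Copin–Panis 2025, Thm 1.5). [cite: DuminilCopinPanis2025LowerBounds, Theorem 1.5] -/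
theorem window_of_conjunct_witness (hρ : ∀ δ ∈ Set.Ioc (0:ℝ) 1, 0 < ρ δ)
    (hlim : HasPointwiseScalingLimit (criticalCorr 3) ρ S) (hnd : IsNondegenerateTwoPoint S)
    (hsc : IsScaleCovariant Δ S) (hU : HasNontrivialU4 S) : 1 / 2 < Δ ∧ Δ ≤ 3 / 4 :=
  ⟨half_lt_of_hasNontrivialU4 hρ hlim hnd hsc hU, (dimension_window_and_eta hρ hlim hnd hsc).1.2⟩

end Window

/-! ### Under the exact Coulomb law every pointwise limit is Gaussian at order four -/

/-- **The Coulomb law kills `U₄` of EVERY limit.** If `⟨σ₀σ_x⟩⁺_{β_c(3)}·|x|₂^{2·(1/2)} → c > 0` cofinitely, then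
every non-degenerate pointwise scaling limit `(ρ, S)` of `criticalCorr 3` — any renormalisation `ρ > 0` on `(0,1]`, no
covariance assumed — has `U₄ ≡ 0` on non-coincident quadruples: its normalisation is scale covariant with the law's
dimension `1/2` (`isScaleCovariant_of_limit`: dilations are free under the law), and `half_lt_of_hasNontrivialU4`
applies. [cite: Pohlmeyer1969, Thm. p. 204] -/
theorem not_hasNontrivialU4_of_coulombLaw {c : ℝ} (hc : 0 < c)
    (hP : Tendsto (fun x : Site 3 =>
      criticalTwoPoint 3 x * Real.sqrt (∑ i, ((x i : ℝ)) ^ 2) ^ (2 * (1 / 2 : ℝ))) cofinite (nhds c))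
    {ρ : ℝ → ℝ} {S : CorrFamily 3} (hρ : ∀ δ ∈ Set.Ioc (0:ℝ) 1, 0 < ρ δ)
    (hlim : HasPointwiseScalingLimit (criticalCorr 3) ρ S) (hnd : IsNondegenerateTwoPoint S) :
    ¬ HasNontrivialU4 S := by
  classical
  intro hU
  set S' : CorrFamily 3 := fun n x => if x ∈ NonCoincident 3 n then S n x else 0 with hS'
  have hlim' : HasPointwiseScalingLimit (criticalCorr 3) ρ S' := normalised_hasLimit hlim
  have hnorm' : ∀ n z, z ∉ NonCoincident 3 n → S' n z = 0 := fun n z hz => by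
    simp only [hS', if_neg hz]
  have hnd' : IsNondegenerateTwoPoint S' := normalised_nondeg hnd
  have hsc' : IsScaleCovariant (1 / 2) S' := isScaleCovariant_of_limit hc hP hρ hlim' hnd' hnorm'
  have hU' : HasNontrivialU4 S' := hasNontrivialU4_normalised_iff.2 hU
  exact not_hasNontrivialU4_of_scaleCovariant_half hρ hlim' hnd' hsc' hU'

/-- **Under the Coulomb law, items 4738 and 0636 are incompatible**: bare existence of a non-degenerate limit
(`WeylWindow.LimitExists`) and non-Gaussianity of all such limits (`IsingEuclidUpgradeR4NonGaussian`) cannot both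
hold if `⟨σ₀σ_x⟩·|x|₂ → c > 0`. [folklore] -/
theorem coulombLaw_limitExists_nonGaussian_false {c : ℝ} (hc : 0 < c)
    (hP : Tendsto (fun x : Site 3 =>
      criticalTwoPoint 3 x * Real.sqrt (∑ i, ((x i : ℝ)) ^ 2) ^ (2 * (1 / 2 : ℝ))) cofinite (nhds c))
    (hL : WeylWindow.LimitExists) (hN : IsingEuclidUpgradeR4NonGaussian) : False := by
  obtain ⟨ρ, S, hρ, hlim, hnd⟩ := hL
  exact not_hasNontrivialU4_of_coulombLaw hc hP hρ hlim hnd (hN ρ S hρ hlim hnd)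

/-! ### `(C)` forbids the Coulomb law -/

/-- **`(C)` ⟹ no exact Coulomb asymptotics (registered bookkeeping stub of this `--supports` file; header on one
line).** If `TwoPointSpineComplement` holds then for NO `c > 0` does `⟨σ₀σ_x⟩⁺_{β_c(3)}·|x|₂^{2·(1/2)} → c`: the
crux at `Δ = 1/2` would produce a non-degenerate Möbius(1/2)-covariant limit with `U₄ ≢ 0`, contradicting
`not_hasNontrivialU4_of_moebius_half`. So `(C)` carries a weak form of `η ≠ 0`. [cite: Pohlmeyer1969, Thm. p. 204] -/
theorem noCoulombLaw_of_twoPointSpineComplement : Summit.CriticalPhenomena.Ising3DConformalLimit.Theses.InverseSquareTelemetry.TwoPointSpineComplement → ∀ c : ℝ, 0 < c → ¬ Filter.Tendsto (fun x : Literature.Probability.LatticeModels.Site 3 => Literature.Probability.LatticeModels.criticalTwoPoint 3 x * Real.sqrt (∑ i, ((x i : ℝ)) ^ 2) ^ (2 * (1 / 2 : ℝ))) Filter.cofinite (nhds c) := by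
  intro h c hc hP
  obtain ⟨ρ, S, hρ, -, hlim, hnd, hm, hU⟩ := h (1 / 2) c hc hP
  exact not_hasNontrivialU4_of_moebius_half hρ hlim hnd hm hU

/-- **In the world `η_law = 0` the crux is false**: the exact Coulomb law refutes `TwoPointSpineComplement`
(contrapositive of `noCoulombLaw_of_twoPointSpineComplement`). The hypothesis is expected to be FALSE
(`η(3) ≈ 0.036 > 0`; it is refuted by item stmt-1342 `NonSaturation`), so this is orientation for the planner, not a
refutation programme. [folklore] -/
theorem not_twoPointSpineComplement_of_coulombLaw
    (hCoul : ∃ c : ℝ, 0 < c ∧ Tendsto (fun x : Site 3 =>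
      criticalTwoPoint 3 x * Real.sqrt (∑ i, ((x i : ℝ)) ^ 2) ^ (2 * (1 / 2 : ℝ))) cofinite (nhds c)) :
    ¬ TwoPointSpineComplement := by
  rintro h
  obtain ⟨c, hc, hP⟩ := hCoul
  exact noCoulombLaw_of_twoPointSpineComplement h c hc hP

/-- **Under `(C)` the law's dimension lies in `(1/2, 3/4]`.** For every witness `(Δ, c)` of the two-point law,
`TwoPointSpineComplement` gives `1/2 < Δ ≤ 3/4` (the crux's own witness is scale covariant with THIS `Δ` and has
`U₄ ≢ 0`; `window_of_conjunct_witness`). [cite: DuminilCopinPanis2025LowerBounds, Theorem 1.5] -/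
theorem window_of_twoPointSpineComplement (h : TwoPointSpineComplement) {Δ c : ℝ} (hc : 0 < c)
    (hP : Tendsto (fun x : Site 3 =>
      criticalTwoPoint 3 x * Real.sqrt (∑ i, ((x i : ℝ)) ^ 2) ^ (2 * Δ)) cofinite (nhds c)) :
    1 / 2 < Δ ∧ Δ ≤ 3 / 4 := by
  obtain ⟨ρ, S, hρ, -, hlim, hnd, hm, hU⟩ := h Δ c hc hP
  exact window_of_conjunct_witness hρ hlim hnd hm.isScaleCovariant hU

/-! ### The corner stub α′, reshaped: inside the line it is the two-point statement α″ = `NoCoulombLaw` -/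

/-- **α′ ⟺ "under the Coulomb law there is no non-degenerate Möbius(1/2) limit".** Since the conclusion
`HasNontrivialU4 S` of α′ is false for every `S` meeting its hypotheses (`not_hasNontrivialU4_of_moebius_half`), the
stub holds iff its hypotheses are never met together. [folklore] -/
theorem stub_coulombCorner_iff_noMoebiusHalfLimit :
    (∀ c : ℝ, 0 < c →
      Tendsto (fun x : Site 3 =>
        criticalTwoPoint 3 x * Real.sqrt (∑ i, ((x i : ℝ)) ^ 2) ^ (2 * (1 / 2 : ℝ))) cofinite (nhds c) →
      ∀ (ρ : ℝ → ℝ) (S : CorrFamily 3), (∀ δ ∈ Set.Ioc (0:ℝ) 1, 0 < ρ δ) →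
        HasPointwiseScalingLimit (criticalCorr 3) ρ S → IsNondegenerateTwoPoint S →
        IsMoebiusCovariant (1 / 2) S → HasNontrivialU4 S) ↔
    (∀ c : ℝ, 0 < c →
      Tendsto (fun x : Site 3 =>
        criticalTwoPoint 3 x * Real.sqrt (∑ i, ((x i : ℝ)) ^ 2) ^ (2 * (1 / 2 : ℝ))) cofinite (nhds c) →
      ∀ (ρ : ℝ → ℝ) (S : CorrFamily 3), (∀ δ ∈ Set.Ioc (0:ℝ) 1, 0 < ρ δ) →
        HasPointwiseScalingLimit (criticalCorr 3) ρ S → IsNondegenerateTwoPoint S →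
        ¬ IsMoebiusCovariant (1 / 2) S) := by
  constructor
  · intro h c hc hP ρ S hρ hlim hnd hm
    exact not_hasNontrivialU4_of_moebius_half hρ hlim hnd hm (h c hc hP ρ S hρ hlim hnd hm)
  · intro h c hc hP ρ S hρ hlim hnd hm
    exact absurd hm (h c hc hP ρ S hρ hlim hnd)

/-- **α″ ⟹ α′ (vacuity).** If the Coulomb law fails for every `c > 0`, the corner stub holds. [folklore] -/
theorem stub_coulombCorner_of_noCoulombLaw
    (hα : ∀ c : ℝ, 0 < c → ¬ Tendsto (fun x : Site 3 =>
      criticalTwoPoint 3 x * Real.sqrt (∑ i, ((x i : ℝ)) ^ 2) ^ (2 * (1 / 2 : ℝ))) cofinite (nhds c)) :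
    ∀ c : ℝ, 0 < c →
      Tendsto (fun x : Site 3 =>
        criticalTwoPoint 3 x * Real.sqrt (∑ i, ((x i : ℝ)) ^ 2) ^ (2 * (1 / 2 : ℝ))) cofinite (nhds c) →
      ∀ (ρ : ℝ → ℝ) (S : CorrFamily 3), (∀ δ ∈ Set.Ioc (0:ℝ) 1, 0 < ρ δ) →
        HasPointwiseScalingLimit (criticalCorr 3) ρ S → IsNondegenerateTwoPoint S →
        IsMoebiusCovariant (1 / 2) S → HasNontrivialU4 S :=
  fun c hc hP => absurd hP (hα c hc)

end Summit.CriticalPhenomena.Ising3DConformalLimit.InverseSquareTelemetryTwoPointSpineComplement.HalfEdge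

end
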